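import Mathlib
import Literature.Analysis.FluidPDE.VectorCalculus
import Summits.NavierStokesRegularity.NavierStokesRegularity.Theorems.ThreadingFluxCentreJetDefs
import HarnessLib

/-!
# Crux `PoloidalLiouville` (stmt-NavierStokesRegularity-1222, wall W1), crux idea «centre-virial» (ns-idea-15 g9, lens «negation»):
# the objects and typed statements of the card, Theorems-side (twin of the sketch, bodies VERBATIM)

Definition file: the Theorems-side twin of the crux workfile `Cruxes/PoloidalLiouville/CentreVirialSketch.lean` v1.1
(sha16 24ac634430392416; verdict V25 PASS-WITH-PRICE of the critic of record ns-wall-crit-1 g4, prices P1–P4 paid), in the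
namespace `…Theorems.PoloidalLiouville.CentreVirial` instead of the sketch's `…Cruxes.PoloidalLiouville.CentreVirial`, so that
kernel theorems under `Theorems/` can conclude the card's statements BY NAME without importing a crux workfile (same device as
`ThreadingFluxCentreJetDefs.lean`, `ThreadingFluxAzimuthalCartanDefs.lean`).  Contents, bodies verbatim against the sketch:

* objects (sketch l.77–105): `mom` (loop momentum `⟪x − x₀, u x⟫ = r u_r`), `radialFluxDeriv` (`∂_r(r² u_r)`), `virialField`
  (`F = p y + m u + curl u × y`), `shell`, `tanDensity` / `radDensity` (`r⁻³|u_tan|²`, `r⁻³u_r²`), `IsDSolution` (classical steady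
  Navier–Stokes on `ℝ³`, finite Dirichlet integral, `u → 0` at infinity — Leray–Galdi class `D` with the decay carried as a field);
* statements (sketch l.109–190, l.231–252): (V0) `RadialMomentVanishes`, (V1) `CentreVirialIdentity`, (V1′) `WeightedVirialIdentity`,
  (F1) `DSolutionPressureLimit`, (F2) `HeadNonpositive`, (T1) `RadialDominanceLiouville`, (H) `HodgeSlavingShell`,
  (T2) `PoloidalTameLiouville`, (T0) `SteadyPoloidalDLiouville` (OPEN conjecture — typed, never asserted), (GAL) `SteadyDLiouville`
  (the sketch's `GaldiLiouville`, RENAMED here because `GaldiLiouville` is the registry name of item stmt-…-0895 — OPEN conjecture of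
  the literature, typed, never asserted), (W1ᴰ) `WallOnSteadyDecayingStratum`, (B) `FluxProfile`.

The sketch's `abbrev E3` is replaced by the identical `CentreJet.E3 = EuclideanSpace ℝ (Fin 3)` of `ThreadingFluxCentreJetDefs`
(which also supplies `IsUnthreadedAbout`, `IsSteadyNSOn`, exactly as the sketch opens them); nothing else differs.  The sketch's
kernel glue (K0–K7) is NOT twinned here (it is re-proved over these names in the sequel proof files, credited to the card).

WHAT THIS IS NOT: no statement here is asserted; `PoloidalLiouville` (1222), T0 and Galdi's Liouville problem stay OPEN; the card's
booking (V25-P3) is «information-grade portrait theorems on the steady decaying stratum; W1 movement 0; T0 no rung credit».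
NS regularity is NOT proved by anything in this line.  `--supports stmt-NavierStokesRegularity-1222 --as helper`.
Author of the statements: planner ns-idea-15 g9; filed Theorems-side by ns-wall-eng-4 g6 (cell ns-wall-extremal).
[cite: Galdi2011, Thm X.5.1] [cite: KorobkovPileckasRusso2015, Thm 3.6]
-/

-- the summit and its single sub-problem share the name (CONVENTIONS §1)
set_option linter.dupNamespace false

noncomputable section

namespace Summit.NavierStokesRegularity.NavierStokesRegularity.Theorems.PoloidalLiouville.CentreVirial

open Set Function MeasureTheory Filter Topology
open Literature.Analysis.FluidPDE (cross curl frobeniusNormSq)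
open Literature.Analysis.FluidPDE.VectorCalculus (divergence IsDivFree)
open Summit.NavierStokesRegularity.NavierStokesRegularity.Theorems.PoloidalLiouville.CentreJet
  (E3 IsUnthreadedAbout IsSteadyNSOn)

/-! ## Objects (sketch l.77–105, verbatim) -/

/-- Loop momentum `m(x) = ⟪x − x₀, u(x)⟫ = r·u_r` (radial velocity times radius). -/
def mom (x₀ : E3) (u : E3 → E3) (x : E3) : ℝ := inner ℝ (x - x₀) (u x)

/-- Radial flux derivative `∂_r(r² u_r) = m + Dm·(x − x₀)` (derivative of `r·m` along the unit radial direction). -/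
def radialFluxDeriv (x₀ : E3) (u : E3 → E3) (x : E3) : ℝ :=
  mom x₀ u x + fderiv ℝ (mom x₀ u) x (x - x₀)

/-- The centre-virial flux field `F = p·y + m·u + curl u × y`, `y = x − x₀`. -/
def virialField (x₀ : E3) (u : E3 → E3) (p : E3 → ℝ) (x : E3) : E3 :=
  p x • (x - x₀) + mom x₀ u x • u x + cross (curl u x) (x - x₀)

/-- The open spherical shell `a < |x − x₀| < b`. -/
def shell (x₀ : E3) (a b : ℝ) : Set E3 := {x | a < ‖x - x₀‖ ∧ ‖x - x₀‖ < b}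

/-- `r⁻³`-weighted tangential kinetic energy density `r⁻⁵(r²|u|² − m²) = r⁻³ |u_tan|²`. -/
def tanDensity (x₀ : E3) (u : E3 → E3) (x : E3) : ℝ :=
  (‖x - x₀‖ ^ 2 * ‖u x‖ ^ 2 - mom x₀ u x ^ 2) / ‖x - x₀‖ ^ 5

/-- `r⁻³`-weighted radial kinetic energy density `r⁻⁵ m² = r⁻³ u_r²`. -/
def radDensity (x₀ : E3) (u : E3 → E3) (x : E3) : ℝ :=
  mom x₀ u x ^ 2 / ‖x - x₀‖ ^ 5

/-- Leray–Galdi `D`-solution on `ℝ³`: classical steady Navier–Stokes (`ν = 1`, no force), finite Dirichlet integral,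
uniform decay `u → 0` at infinity.  (The class of Galdi's Liouville CONJECTURE; regular by Galdi 2011 Thm X.1.1.)
TYPING NOTE (v1.1, critic V25-P4): the decay `Tendsto u (cocompact E3) (𝓝 0)` is carried as a FIELD; for `Ḣ¹` steady solutions
it is a THEOREM (Galdi 2011 X.5.1 / elliptic regularity), so this class is nominally NARROWER than Galdi's / Vergara-Hermosilla's `Ḣ¹`
class — harmless for Liouville statements (it only weakens them nominally); a later version may replace the field by a cited fact. -/
def IsDSolution (u : E3 → E3) (p : E3 → ℝ) : Prop :=
  IsSteadyNSOn univ u p ∧ Integrable (fun x => frobeniusNormSq (fderiv ℝ u x)) ∧ Tendsto u (cocompact E3) (𝓝 0)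

/-! ## V — the centre-virial identities; F — literature inputs (sketch l.109–141, verbatim) -/

/-- (V0, S) **Radial moments of divergence-free fields vanish on balls**: `∫_{B_t(x₀)} φ(|y|)⟪y, w⟫ = 0`
(`φ(r) y = ∇Ψ(r)`, `Ψ′ = rφ`; `∫ ⟪∇Ψ, w⟫ = Ψ(t)·∮_{S_t} w·ŷ = Ψ(t) ∫_{B_t} div w = 0`).  Applied to `w = ∂ₜu` it removes the
time derivative from the integrated virial identities: they hold slice-wise for UNSTEADY incompressible flows. -/
def RadialMomentVanishes : Prop :=
  ∀ (x₀ : E3) (w : E3 → E3) (φ : ℝ → ℝ) (t : ℝ), ContDiff ℝ 1 w → IsDivFree w → Continuous φ → 0 < t →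
    ∫ x in Metric.ball x₀ t, φ ‖x - x₀‖ * inner ℝ (x - x₀) (w x) = 0

/-- (V1, S) **Centre-virial identity**: for a classical steady flow, `div F = 3p + |u|²` with `F = p y + m u + curl u × y`.
Integrated over `B_t(x₀)`: `t ∮_{S_t}(p + u_r²) dσ = ∫_{B_t}(3p + |u|²) dx` (the flux of `curl u × y` through spheres is zero). -/
def CentreVirialIdentity : Prop :=
  ∀ (u : E3 → E3) (p : E3 → ℝ) (x₀ : E3), IsSteadyNSOn univ u p →
    ∀ x, divergence (virialField x₀ u p) x = 3 * p x + ‖u x‖ ^ 2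

/-- (V1′, S) **Weighted centre-virial identity** (test field `y/|y|³`, divergence-free off `x₀`):
`div (r⁻³ F) = r⁻⁵ (r²|u|² − 3m²) = r⁻³(|u_tan|² − 2u_r²)` off `x₀`.  Integrated over a shell:
`G(b) − G(a) = ∫_{a<r<b} r⁻³(|u_tan|² − 2u_r²)`, `G(t) := t⁻² ∮_{S_t}(p + u_r²) dσ`. -/
def WeightedVirialIdentity : Prop :=
  ∀ (u : E3 → E3) (p : E3 → ℝ) (x₀ : E3), IsSteadyNSOn univ u p →
    ∀ x, x ≠ x₀ → divergence (fun y => (‖y - x₀‖ ^ 3)⁻¹ • virialField x₀ u p y) x =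
      (‖x - x₀‖ ^ 2 * ‖u x‖ ^ 2 - 3 * mom x₀ u x ^ 2) / ‖x - x₀‖ ^ 5

/-! ## F — literature inputs on `D`-solutions (facts, used as hypotheses on the card) -/

/-- (F1, F) Pressure of a `D`-solution has a uniform limit at infinity [Galdi 2011, Thm X.5.1; used verbatim in
Chae 2021 JMFM (arXiv:2003.05246) p. 4 and KPR 2015]. -/
def DSolutionPressureLimit : Prop :=
  ∀ (u : E3 → E3) (p : E3 → ℝ), IsDSolution u p → ∃ p₀ : ℝ, Tendsto p (cocompact E3) (𝓝 p₀)

/-- (F2, S over F1) **Non-positive head**: `Φ = p − p₀ + |u|²/2 ≤ 0` for a `D`-solution (maximum principle for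
`ΔΦ − u·∇Φ = |curl u|² ≥ 0` with `Φ → 0`; Chae 2021 (hyp), KPR 2015 Thm 3.6 / book Thm 3.6). -/
def HeadNonpositive : Prop :=
  ∀ (u : E3 → E3) (p : E3 → ℝ) (p₀ : ℝ), IsDSolution u p → Tendsto p (cocompact E3) (𝓝 p₀) →
    ∀ x, p x - p₀ + ‖u x‖ ^ 2 / 2 ≤ 0

/-! ## T1, H, T2, T0, GAL, W1ᴰ (sketch l.145–190, verbatim) -/

/-- (T1, T) **Radial-dominance Liouville.**  Let `(u, p)` be a `D`-solution and `x₀` a centre.  If on every shell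
`t₀ ≤ a < r < b` the `r⁻³`-weighted tangential energy is at most twice the radial one,
`∫ r⁻³|u_tan|² ≤ 2 ∫ r⁻³ u_r²`, then `u ≡ 0`.
Proof (card): F2 + (V1) give `t³G(t) ≤ −½∫_{B_t}|u|²`; (V1′) + hypothesis make `G` non-increasing on `[t₀, ∞)`;
F1 + decay give `G(∞) = 0`; so `0 ≤ G(a) ≤ −(2a³)⁻¹ ∫_{B_a}|u|²` for every `a ≥ t₀`. No unique continuation needed. -/
def RadialDominanceLiouville : Prop :=
  ∀ (u : E3 → E3) (p : E3 → ℝ) (x₀ : E3) (t₀ : ℝ), IsDSolution u p → 0 < t₀ →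
    (∀ a b : ℝ, t₀ ≤ a → a < b →
      ∫ x in shell x₀ a b, tanDensity x₀ u x ≤ 2 * ∫ x in shell x₀ a b, radDensity x₀ u x) →
    ∀ x, u x = 0

/-! ## H — Hodge slaving on spheres (poloidal input; S/M: `H¹_dR(S²) = 0` + `λ₁(S_r) = 2/r²`) -/

/-- (H, S) **Hodge slaving.**  If `u ∈ C¹` is divergence-free and unthreaded about `x₀`, then on every sphere `S_r(x₀)`
`u_tan = ∇_S ψ`, `Δ_S ψ = −r⁻² ∂_r(r²u_r)`, and `∮ r²|u_tan|² ≤ ½ ∮ (∂_r(r²u_r))²` (equality iff `ψ` is a first harmonic);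
integrated against `r⁻⁵ dr` over a shell: -/
def HodgeSlavingShell : Prop :=
  ∀ (u : E3 → E3) (x₀ : E3) (a b : ℝ), ContDiff ℝ 1 u → IsDivFree u → IsUnthreadedAbout x₀ u → 0 < a → a < b →
    ∫ x in shell x₀ a b, tanDensity x₀ u x ≤
      (1 / 2) * ∫ x in shell x₀ a b, radialFluxDeriv x₀ u x ^ 2 / ‖x - x₀‖ ^ 5

/-! ## T2 — the poloidal theorem; T0 — the residual conjecture of the stratum -/

/-- (T2, T) **Poloidal tameness Liouville.**  A steady poloidal `D`-solution (`⟪curl u, x − x₀⟫ ≡ 0`) whose radial flux is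
tame outside a ball, `|∂_r(r² u_r)| ≤ 2 r |u_r|` for `|x − x₀| ≥ t₀`, is trivial.  (From T1 + H: tameness makes
`½(∂_r(r²u_r))² ≤ 2 r² u_r²`; kernel glue `poloidalTameLiouville_of` below.) -/
def PoloidalTameLiouville : Prop :=
  ∀ (u : E3 → E3) (p : E3 → ℝ) (x₀ : E3) (t₀ : ℝ), IsDSolution u p → IsUnthreadedAbout x₀ u → 0 < t₀ →
    (∀ x, t₀ ≤ ‖x - x₀‖ → |radialFluxDeriv x₀ u x| ≤ 2 * |mom x₀ u x|) →
    ∀ x, u x = 0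

/-- (T0, C — OPEN; = Galdi's Liouville problem ∩ the poloidal class; the steady decaying stratum of W1)
**Steady poloidal `D`-Liouville.** -/
def SteadyPoloidalDLiouville : Prop :=
  ∀ (u : E3 → E3) (p : E3 → ℝ) (x₀ : E3), IsDSolution u p → IsUnthreadedAbout x₀ u → ∀ x, u x = 0

/-- (GAL, C — OPEN CONJECTURE of the literature, Galdi 2011 / Seregin 2016; NOT a fact, never used as a hypothesis
except in the bookkeeping lemma `steadyPoloidalDLiouville_of_galdi`.)  [Twin note: the sketch calls this Prop `GaldiLiouville`;
renamed `SteadyDLiouville` Theorems-side because `GaldiLiouville` is the registry name of route item stmt-NavierStokesRegularity-0895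
(`GaldiLiouvilleGate`); the BODY is verbatim.] -/
def SteadyDLiouville : Prop :=
  ∀ (u : E3 → E3) (p : E3 → ℝ), IsDSolution u p → ∀ x, u x = 0

/-- (W1ᴰ) The wall's conclusion on this stratum: the vorticity of a steady poloidal `D`-solution vanishes
(`StubScalarLiouville` restricted to time-independent decaying flows concludes `∇T × y = curl u ≡ 0`). -/
def WallOnSteadyDecayingStratum : Prop :=
  ∀ (u : E3 → E3) (p : E3 → ℝ) (x₀ : E3), IsDSolution u p → IsUnthreadedAbout x₀ u → ∀ x, curl u x = 0


/-! ## B — the flux profile (sketch l.231–252, verbatim) -/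


/-- (B, S/M) **Flux profile.**  For a `D`-solution and a centre `x₀` there is a profile `G` — namely
`G(t) = t⁻² ∮_{S_t(x₀)} (p − p₀ + u_r²) dσ` with `p₀` the pressure limit (F1) — satisfying
(i) the BALL INEQUALITY `t³ G(t) ≤ −½ ∫_{B_t} |u|²` ((V1) + divergence theorem + head sign F2: `3(p−p₀)+|u|² ≤ −|u|²/2`),
(ii) the SHELL IDENTITY `G(b) − G(a) = ∫_shell r⁻³|u_tan|² − 2∫_shell r⁻³u_r²` ((V1′) + divergence theorem), and
(iii) DECAY `G(t) → 0` (F1 and `u → 0`).  This packages exactly the PDE input of T1; the rest of T1 is real analysis (K5).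
SPHERE-FREE ROUTE r1 (v1.1, critic V25-P2 — the statement below never mentions a surface measure): take the VOLUME form
`G(t) := t⁻³ ∫_{B_t} (3(p − p₀) + |u|²) dx` (= the surface form by (V1)); (i) is F2 pointwise (`3(p−p₀)+|u|² = 3Φ − |u|²/2`);
(iii) is Cesàro from `p → p₀`, `u → 0`; (ii) is WHOLE-SPACE Gauss–Green applied to the compactly supported Lipschitz field
`(φ_{a,b}(r) − b⁻³) · F`, `φ_{a,b} = (clamp_{[a,b]} r)⁻³`, `F = (p − p₀) y + m u + ω × y` (mollify the two kinks):
`∫_shell div(r⁻³ F) = b⁻³ ∫_{B_b} div F − a⁻³ ∫_{B_a} div F = G(b) − G(a)`, with `div(r⁻³F) = tanDensity − 2·radDensity` by (V1′).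
Size: M given F1, F2. -/
def FluxProfile : Prop :=
  ∀ (u : E3 → E3) (p : E3 → ℝ) (x₀ : E3), IsDSolution u p →
    ∃ G : ℝ → ℝ,
      (∀ t : ℝ, 0 < t → t ^ 3 * G t ≤ -(1 / 2) * ∫ x in Metric.ball x₀ t, ‖u x‖ ^ 2) ∧
      (∀ a b : ℝ, 0 < a → a < b →
          G b - G a = (∫ x in shell x₀ a b, tanDensity x₀ u x) - 2 * ∫ x in shell x₀ a b, radDensity x₀ u x) ∧
      Tendsto G atTop (𝓝 0)

end Summit.NavierStokesRegularity.NavierStokesRegularity.Theorems.PoloidalLiouville.CentreVirial
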